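import Summits.QuantumFields.YangMills.Theorems.FemtoCutoffLadderThinning
import Summits.QuantumFields.YangMills.Theorems.FemtoTransferGapBounds
import Literature.MathematicalPhysics.QuantumFieldTheory.TorusConfigShift
import HarnessLib

/-!
# Route `FemtoCutoffLadder` — TRANSLATION-AVERAGED thinning pull-backs: the de-aliased trial multiplier for the variational steps of crux
# `SubOctaveBounded` (stmt-QuantumFields-24085; children `DyadicNestedUpper` 25766, reshape `UpStepEv` / `DynComparison`)

Seat `ym-line-fcl-p3` g4 (2026-08-28).  Rung R2b1 = the RECORD-label femto transfer gap — not infinite volume, not the Clay mass gap; no summit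
and no step of the route is proved by this module.

WHY (memo `Cruxes/SubOctaveBounded/ALIASING.md`, evidence on 24085 and 25766; a leading-order femto-universe accounting, NOT a kernel fact): the
variational steps of the crux («fine gap ≤ coarse gap + CΛ²») are to be witnessed by ONE fine physical trial multiplier, named in three places as
the RAW pull-back `g' ∘ B` of the coarse first excitation `g' = e₁'/Ω'` along a blocking `B` (the straight corner transporters `B_{2^k}` of
25766, or the thinning map `thin` of `FemtoCutoffLadderThinningDefs`).  Any such `B` samples the fine line holonomies on the image transverse
positions only, so the coarse zero mode of `B U` equals the fine zero mode PLUS a linear combination of fine one-gluon modes (aliasing); in the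
ground-state representation this costs a fraction `p₁ ≈ 2ε₁·Λ·S` of the trial vector's variance (`S = 0.68/L` for `B_2`, `≈ 0.32·2^k/L'` for
`B_{2^k}`, `→ 0.016` with NO decay in `L` for the front-loaded `thin`), which the per-coarse-step deficit door re-charges `L'` times
(`≈ 0.66ε₁Λ ≫ CΛ²` at `k = 1`) and the physical-time-1 door once (`≈ p₁`).  Averaging the pull-back over all fine TRANSLATIONS,
`f̄(U) = |(ℤ/L)³|⁻¹ Σ_v g'(B(τ_v U))`, kills the linear aliasing identically (a translation-invariant linear functional is diagonal in momentum).
This module supplies the kinematics of `f̄` in the tree's vocabulary (`τ_v = TorusTranslation.torusConfigShift v`, `(τ_v U)(x,i) = U(x − v, i)`):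

* §1 (any group `G`; fleet service, namespace `FemtoTransferGap`) `torusConfigShift_gaugeTransform` (`τ_v(U^g) = (τ_v U)^{g(· − v)}`),
  `torusConfigShift_twist_of_apply_eq_zero` (a translation inside the twist plane commutes with the twist), `torusConfigShift_negSingle_twist`
  (the unit translation along `k` carries the twist through `x_k = 0` to the twist through the parallel plane `x_k = −1`), `gaugeTransform_slab_axis`
  (those two twists differ by the slab gauge transformation `z·𝟙_{x_k = 0}` — the axis-`k` copy of `gaugeTransform_slab`), whence
  ★ `IsPhys.comp_torusConfigShift : IsPhys ψ → IsPhys (ψ ∘ τ_v)` for EVERY `v` (via unit steps, `torusConfigShift_torusConfigShift`);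
  `measurePreserving_torusConfigShift_configMeasure`, `integral_comp_torusConfigShift`, `l2_comp_torusConfigShift` (product Haar is translation invariant).
* §2 (compact second-countable `G`, `L' ≤ L ≤ 2L'`; namespace `FemtoCutoffLadder.Thinning`) for a coarse physical `ψ` and the averaged pull-back
  `f̄(U) = (card (Site 3 L))⁻¹ · Σ_v ψ(thin L' (τ_v U))` (written out, no new definition):
  ★ `isPhys_avg_thin_shift` (physical), ★ `integral_avg_thin_shift` (`∫ f̄ dHaar_L = ∫ ψ dHaar_{L'}`: the mean is that of `ψ`),
  ★ `l2_avg_thin_shift_le` (`‖f̄‖²_{L²(Haar_L)} ≤ ‖ψ‖²_{L²(Haar_{L'})}`, Jensen on the finite average + `thin_* Haar = Haar`).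

What is NOT here: any statement about the fine VACUUM-weighted moments of `f̄` (the three-moment supplier interface
`UpStep.upStepAt_of_moments` takes an arbitrary physical `w`; with `w = f̄·Ω` it is unchanged) — that is the two-cutoff content of the step
(barrier `UVStabilityNonUniqueness`).  No definitions, no named facts, no `sorry`.
-/

set_option autoImplicit false

noncomputable section

open MeasureTheory
open Literature.MathematicalPhysics.QuantumFieldTheory
open Literature.MathematicalPhysics.QuantumFieldTheory.TorusTranslation

/-! ## §1 Translations of the spatial torus versus gauge transformations, centre twists, physical test functions and the a-priori measure -/

namespace Summit.QuantumFields.YangMills.Theorems.FemtoTransferGap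

section TranslationAlgebra

variable {G : Type*} [Group G] [MeasurableSpace G] {L : ℕ}

/-- `τ_v (U^g) = (τ_v U)^{g(· − v)}`: a translation conjugates a gauge transformation into a gauge transformation. [folklore] -/
theorem torusConfigShift_gaugeTransform (v : Site 3 L) (g : Site 3 L → G) (U : GaugeConfig 3 L G) :
    torusConfigShift v (gaugeTransform g U) = gaugeTransform (fun x => g (x - v)) (torusConfigShift v U) := by
  funext e
  have hs : (e.1 - v).shift e.2 = e.1.shift e.2 - v := by
    simp only [Site.shift]; abel
  simp only [torusConfigShift_apply, gaugeTransform, hs]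

/-- A translation by a vector INSIDE the plane `x_k = 0` (`v k = 0`) commutes with the centre twist through that plane. [cite: tHooft1979] -/
theorem torusConfigShift_twist_of_apply_eq_zero {v : Site 3 L} {k : Fin 3} (hv : v k = 0) (z : G) (U : GaugeConfig 3 L G) :
    torusConfigShift v (twist k z U) = twist k z (torusConfigShift v U) := by
  funext e
  simp only [torusConfigShift_apply, twist, Pi.sub_apply, hv, sub_zero]

/-- The unit translation `τ_{−e_k}` (`(τ U)(x,i) = U(x + e_k, i)`) carries the centre twist through the plane `x_k = 0` to the twist through the
PARALLEL plane `x_k = −1` (the links `(x,k)` with `(x + e_k)_k = 0`). [cite: tHooft1979] -/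
theorem torusConfigShift_negSingle_twist (k : Fin 3) (z : G) (U : GaugeConfig 3 L G) :
    torusConfigShift (-(Pi.single k 1)) (twist k z U) =
      fun e => if e.2 = k ∧ (e.1.shift k) k = 0 then z * torusConfigShift (-(Pi.single k 1)) U e
        else torusConfigShift (-(Pi.single k 1)) U e := by
  funext e
  simp only [torusConfigShift_apply, twist, sub_neg_eq_add, Site.shift]

omit [Group G] in
/-- Two translations compose to the translation by the sum. [folklore] -/
theorem torusConfigShift_torusConfigShift (a b : Site 3 L) (U : GaugeConfig 3 L G) :
    torusConfigShift a (torusConfigShift b U) = torusConfigShift (a + b) U := by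
  funext e
  simp only [torusConfigShift_apply, sub_sub]

omit [Group G] in
/-- The translation by `0` is the identity. [folklore] -/
theorem torusConfigShift_zero (U : GaugeConfig 3 L G) : torusConfigShift (0 : Site 3 L) U = U := by
  funext e
  simp only [torusConfigShift_apply, sub_zero, Prod.mk.eta]

omit [MeasurableSpace G] in
/-- A twist followed by the inverse twist through the same plane cancels: `twist_k(z) (twist_k(z⁻¹) U) = U`. [folklore] -/
theorem twist_twist_inv (k : Fin 3) (z : G) (U : GaugeConfig 3 L G) : twist k z (twist k z⁻¹ U) = U := by
  funext e
  by_cases h : e.2 = k ∧ e.1 k = 0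
  · simp only [twist, h, and_self, if_true, mul_inv_cancel_left]
  · simp only [twist, h, if_false]

omit [MeasurableSpace G] in
/-- **Slab gauge transformation, axis `k`** (the axis-`k` copy of `gaugeTransform_slab`): with `g(x) = z` if `x_k = 0`, `g(x) = 1` otherwise
(`z` central), `W^g = twist_k(z) (twist'_k(z⁻¹) W)`, where `twist'_k` is the twist through the parallel plane `x_k = −1` of
`torusConfigShift_negSingle_twist`.  Twists through parallel planes differ by a gauge transformation. [cite: tHooft1979] -/
theorem gaugeTransform_slab_axis {z : G} (hz : z ∈ Subgroup.center G) (k : Fin 3) (W : GaugeConfig 3 L G) :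
    gaugeTransform (fun x : Site 3 L => if x k = 0 then z else 1) W =
      twist k z (fun e => if e.2 = k ∧ (e.1.shift k) k = 0 then z⁻¹ * W e else W e) := by
  have hzc : ∀ g : G, g * z = z * g := fun g => Subgroup.mem_center_iff.mp hz g
  have hzc' : ∀ g : G, g * z⁻¹ = z⁻¹ * g := fun g => Subgroup.mem_center_iff.mp (Subgroup.inv_mem _ hz) g
  funext e
  obtain ⟨x, μ⟩ := e
  by_cases hμ : μ = k
  · subst hμ
    by_cases hA : x μ = 0
    · by_cases hB : (x.shift μ) μ = 0
      · simp only [gaugeTransform, twist, hA, hB, if_true, and_self]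
        rw [mul_assoc, hzc' (W (x, μ))]
      · simp only [gaugeTransform, twist, hA, hB, if_true, if_false, and_false, and_true, inv_one, mul_one]
    · by_cases hB : (x.shift μ) μ = 0
      · simp only [gaugeTransform, twist, hA, hB, if_true, if_false, and_true, and_false, one_mul]
        exact hzc' _
      · simp only [gaugeTransform, twist, hA, hB, if_false, and_false, one_mul, inv_one, mul_one]
  · have hs : (x.shift μ) k = x k := by
      simp only [Site.shift, Pi.add_apply, Pi.single_apply, if_neg (fun h : k = μ => hμ h.symm), add_zero]
    by_cases hA : x k = 0
    · simp only [gaugeTransform, twist, hμ, hs, hA, if_true, false_and, if_false]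
      rw [← hzc, mul_inv_cancel_right]
    · simp only [gaugeTransform, twist, hμ, hs, hA, if_false, false_and, one_mul, inv_one, mul_one]

end TranslationAlgebra

section TranslationPhys

variable {G : Type*} [Group G] [MeasurableSpace G] {L : ℕ}

/-- The unit translation `τ_{−e_k}` of a physical zero-flux test function is physical: measurable, bounded, gauge invariant
(`torusConfigShift_gaugeTransform`); twist invariant — directly for the planes `x_j = 0`, `j ≠ k` (`torusConfigShift_twist_of_apply_eq_zero`), and for
`j = k` because the translated twist is the twist through the parallel plane `x_k = −1`, which is the original one up to the slab gauge transformation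
(`torusConfigShift_negSingle_twist`, `gaugeTransform_slab_axis`, `twist_mul`). [cite: Luscher1983, §2] [cite: tHooft1979] -/
theorem IsPhys.comp_torusConfigShift_negSingle {ψ : GaugeConfig 3 L G → ℝ} (hψ : IsPhys ψ) (k : Fin 3) :
    IsPhys fun U => ψ (torusConfigShift (-(Pi.single k (1 : ZMod L))) U) := by
  obtain ⟨C, hC⟩ := hψ.bounded
  refine ⟨hψ.measurable.comp (torusConfigShift _).measurable, ⟨C, fun U => hC _⟩, fun g U => ?_, fun j z hz U => ?_⟩
  · show ψ (torusConfigShift _ (gaugeTransform g U)) = ψ (torusConfigShift _ U)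
    rw [torusConfigShift_gaugeTransform, hψ.gaugeInv]
  · show ψ (torusConfigShift _ (twist j z U)) = ψ (torusConfigShift _ U)
    by_cases hj : j = k
    · subst hj
      set W := torusConfigShift (-(Pi.single j (1 : ZMod L))) U with hW
      have hzi : z⁻¹ ∈ Subgroup.center G := Subgroup.inv_mem _ hz
      -- the translated twist is `twist'_j(z) W = twist_j(z) (W^g)` with the slab gauge function `g = z⁻¹·𝟙_{x_j = 0}`
      have key : (fun e => if e.2 = j ∧ (e.1.shift j) j = 0 then z * W e else W e) =
          twist j z (gaugeTransform (fun x : Site 3 L => if x j = 0 then z⁻¹ else 1) W) := by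
        rw [gaugeTransform_slab_axis hzi j W, twist_twist_inv]
        simp only [inv_inv]
      rw [torusConfigShift_negSingle_twist, ← hW, key, hψ.zeroFlux j z hz, hψ.gaugeInv]
    · have hv : (-(Pi.single k (1 : ZMod L)) : Site 3 L) j = 0 := by
        simp only [Pi.neg_apply, Pi.single_apply, if_neg hj, neg_zero]
      rw [torusConfigShift_twist_of_apply_eq_zero hv, hψ.zeroFlux j z hz]

/-- Iterated unit translations: `ψ ∘ τ_{−n e_k}` is physical for every `n : ℕ`. [folklore] -/
theorem IsPhys.comp_torusConfigShift_negSingle_natCast {ψ : GaugeConfig 3 L G → ℝ} (hψ : IsPhys ψ) (k : Fin 3) (n : ℕ) :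
    IsPhys fun U => ψ (torusConfigShift (-(Pi.single k (n : ZMod L))) U) := by
  induction n with
  | zero =>
    simp only [Nat.cast_zero, Pi.single_zero, neg_zero, torusConfigShift_zero]
    exact hψ
  | succ n ih =>
    have h := ih.comp_torusConfigShift_negSingle k
    have hsum : (-(Pi.single k (n : ZMod L)) : Site 3 L) + -(Pi.single k (1 : ZMod L)) = -(Pi.single k ((n + 1 : ℕ) : ZMod L)) := by
      rw [Nat.cast_succ, Pi.single_add, neg_add]
    simp only [torusConfigShift_torusConfigShift, hsum] at h
    exact h

/-- ★ **Translates of physical zero-flux test functions are physical**: `IsPhys ψ → IsPhys (ψ ∘ τ_v)` for every `v ∈ (ℤ/L)³`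
(every `v` is a sum of natural multiples of the negative unit vectors). [cite: Luscher1983, §2] [cite: tHooft1979] -/
theorem IsPhys.comp_torusConfigShift [NeZero L] {ψ : GaugeConfig 3 L G → ℝ} (hψ : IsPhys ψ) (v : Site 3 L) :
    IsPhys fun U => ψ (torusConfigShift v U) := by
  -- `v = a + b + c` with `a = −n₀e₀`, `b = −n₁e₁`, `c = −n₂e₂`, `n_j = val(−v_j)`
  set a : Site 3 L := -(Pi.single 0 (((-v) 0).val : ZMod L)) with ha
  set b : Site 3 L := -(Pi.single 1 (((-v) 1).val : ZMod L)) with hb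
  set c : Site 3 L := -(Pi.single 2 (((-v) 2).val : ZMod L)) with hc
  have hv : v = a + (b + c) := by
    ext j
    simp only [ha, hb, hc, ZMod.natCast_zmod_val, Pi.add_apply, Pi.neg_apply, Pi.single_apply]
    fin_cases j <;> simp
  have h1 : IsPhys fun U => ψ (torusConfigShift a U) := hψ.comp_torusConfigShift_negSingle_natCast 0 _
  have h2 : IsPhys fun U => ψ (torusConfigShift a (torusConfigShift b U)) := h1.comp_torusConfigShift_negSingle_natCast 1 _
  have h3 : IsPhys fun U => ψ (torusConfigShift a (torusConfigShift b (torusConfigShift c U))) :=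
    h2.comp_torusConfigShift_negSingle_natCast 2 _
  simp only [torusConfigShift_torusConfigShift] at h3
  rw [hv]
  exact h3

end TranslationPhys

section TranslationMeasure

variable {G : Type*} [Group G] [TopologicalSpace G] [IsTopologicalGroup G] [CompactSpace G] [MeasurableSpace G] [BorelSpace G]
  {L : ℕ} [NeZero L]

variable (G) in
/-- Translations preserve the a-priori product Haar measure `configMeasure`. [folklore] -/
theorem measurePreserving_torusConfigShift_configMeasure (v : Site 3 L) :
    MeasurePreserving (torusConfigShift v) (configMeasure G L) (configMeasure G L) := by
  unfold configMeasure
  exact measurePreserving_arrowCongr' (fun _ : Edge 3 L => haarProbability G) (fun _ : Edge 3 L => haarProbability G)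
    (torusEdgeShift v) (MeasurableEquiv.refl G) fun _ => MeasurePreserving.id _

/-- Change of variables `∫ F(τ_v U) dU = ∫ F(U) dU`. [folklore] -/
theorem integral_comp_torusConfigShift (v : Site 3 L) (F : GaugeConfig 3 L G → ℝ) :
    ∫ U, F (torusConfigShift v U) ∂configMeasure G L = ∫ U, F U ∂configMeasure G L :=
  (measurePreserving_torusConfigShift_configMeasure G v).integral_comp' (f := torusConfigShift v) F

/-- `⟨ψ ∘ τ_v, φ ∘ τ_v⟩ = ⟨ψ, φ⟩`. [folklore] -/
theorem l2_comp_torusConfigShift (v : Site 3 L) (ψ φ : GaugeConfig 3 L G → ℝ) :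
    l2 (fun U => ψ (torusConfigShift v U)) (fun U => φ (torusConfigShift v U)) = l2 ψ φ := by
  unfold l2
  exact integral_comp_torusConfigShift v (fun U => ψ U * φ U)

end TranslationMeasure

end Summit.QuantumFields.YangMills.Theorems.FemtoTransferGap

/-! ## §2 The translation-averaged thinning pull-back `f̄ = |Λ_L|⁻¹ Σ_v ψ ∘ thin L' ∘ τ_v` -/

namespace Summit.QuantumFields.YangMills.Theorems.FemtoCutoffLadder.Thinning

open Summit.QuantumFields.YangMills.Theorems.FemtoTransferGap

section Averaged

variable {L L' : ℕ} [NeZero L] [NeZero L'] {G : Type*} [Group G] [TopologicalSpace G] [IsTopologicalGroup G] [CompactSpace G]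
  [T2Space G] [SecondCountableTopology G] [MeasurableSpace G] [BorelSpace G]

omit [CompactSpace G] [T2Space G] in
/-- Each translated pull-back `ψ ∘ thin L' ∘ τ_v` of a coarse physical test function is a fine physical test function. [cite: Luscher1983, §2] -/
theorem isPhys_thin_shift (hLL : L' ≤ L) (h2 : L ≤ 2 * L') {ψ : GaugeConfig 3 L' G → ℝ} (hψ : IsPhys ψ) (v : Site 3 L) :
    IsPhys fun U : GaugeConfig 3 L G => ψ (thin L' (torusConfigShift v U)) :=
  (isPhys_comp_thin hLL h2 hψ).comp_torusConfigShift v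

omit [CompactSpace G] [T2Space G] in
/-- ★ **The translation-averaged thinning pull-back is physical**: `f̄(U) = |Λ_L|⁻¹ Σ_{v ∈ (ℤ/L)³} ψ(thin L' (τ_v U))` is a bounded measurable
gauge- and twist-invariant function of the fine configuration whenever `ψ` is physical on the coarse torus (`L' ≤ L ≤ 2L'`). [cite: Luscher1983, §2] -/
theorem isPhys_avg_thin_shift (hLL : L' ≤ L) (h2 : L ≤ 2 * L') {ψ : GaugeConfig 3 L' G → ℝ} (hψ : IsPhys ψ) :
    IsPhys fun U : GaugeConfig 3 L G =>
      (Fintype.card (Site 3 L) : ℝ)⁻¹ * ∑ v : Site 3 L, ψ (thin L' (torusConfigShift v U)) := by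
  have hterm := fun v : Site 3 L => isPhys_thin_shift hLL h2 hψ v
  obtain ⟨C, hC⟩ := hψ.bounded
  refine ⟨?_, ?_, fun g U => ?_, fun k z hz U => ?_⟩
  · exact (Finset.measurable_sum _ fun v _ => (hterm v).measurable).const_mul _
  · refine ⟨C, fun U => ?_⟩
    have hcard : (0 : ℝ) < Fintype.card (Site 3 L) := by exact_mod_cast Fintype.card_pos
    rw [abs_mul, abs_inv, abs_of_pos hcard]
    calc (Fintype.card (Site 3 L) : ℝ)⁻¹ * |∑ v : Site 3 L, ψ (thin L' (torusConfigShift v U))|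
        ≤ (Fintype.card (Site 3 L) : ℝ)⁻¹ * ∑ v : Site 3 L, C := by
          refine mul_le_mul_of_nonneg_left ((Finset.abs_sum_le_sum_abs _ _).trans (Finset.sum_le_sum fun v _ => hC _)) ?_
          positivity
      _ = C := by
          rw [Finset.sum_const, Finset.card_univ, nsmul_eq_mul, inv_mul_cancel_left₀ hcard.ne']
  · show (Fintype.card (Site 3 L) : ℝ)⁻¹ * ∑ v : Site 3 L, ψ (thin L' (torusConfigShift v (gaugeTransform g U))) =
      (Fintype.card (Site 3 L) : ℝ)⁻¹ * ∑ v : Site 3 L, ψ (thin L' (torusConfigShift v U))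
    congr 1
    exact Finset.sum_congr rfl fun v _ => (hterm v).gaugeInv g U
  · show (Fintype.card (Site 3 L) : ℝ)⁻¹ * ∑ v : Site 3 L, ψ (thin L' (torusConfigShift v (twist k z U))) =
      (Fintype.card (Site 3 L) : ℝ)⁻¹ * ∑ v : Site 3 L, ψ (thin L' (torusConfigShift v U))
    congr 1
    exact Finset.sum_congr rfl fun v _ => (hterm v).zeroFlux k z hz U

/-- ★ **The averaged pull-back has the mean of `ψ`**: `∫ f̄ dHaar_L = ∫ ψ dHaar_{L'}` (translation invariance of product Haar and
`thin_* Haar = Haar`). [folklore] -/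
theorem integral_avg_thin_shift (hLL : L' ≤ L) (h2 : L ≤ 2 * L') {ψ : GaugeConfig 3 L' G → ℝ} (hψ : IsPhys ψ) :
    ∫ U, (Fintype.card (Site 3 L) : ℝ)⁻¹ * ∑ v : Site 3 L, ψ (thin L' (torusConfigShift v U)) ∂configMeasure G L =
      ∫ V, ψ V ∂configMeasure G L' := by
  have hcard : (Fintype.card (Site 3 L) : ℝ) ≠ 0 := by exact_mod_cast Fintype.card_ne_zero
  have hint : ∀ v : Site 3 L, Integrable (fun U : GaugeConfig 3 L G => ψ (thin L' (torusConfigShift v U))) (configMeasure G L) :=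
    fun v => (isPhys_thin_shift hLL h2 hψ v).integrable
  have hterm : ∀ v : Site 3 L, ∫ U, ψ (thin L' (torusConfigShift v U)) ∂configMeasure G L = ∫ V, ψ V ∂configMeasure G L' := by
    intro v
    rw [integral_comp_torusConfigShift v (fun U => ψ (thin L' U)), integral_comp_thin hLL hψ.measurable]
  rw [integral_const_mul, integral_finsetSum _ fun v _ => hint v]
  simp only [hterm, Finset.sum_const, Finset.card_univ, nsmul_eq_mul]
  rw [inv_mul_cancel_left₀ hcard]

/-- ★ **The averaged pull-back is an `L²(Haar)` contraction**: `‖f̄‖² ≤ ‖ψ‖²` (Jensen on the finite average, then translation invariance and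
`thin_* Haar = Haar` term by term). [folklore] -/
theorem l2_avg_thin_shift_le (hLL : L' ≤ L) (h2 : L ≤ 2 * L') {ψ : GaugeConfig 3 L' G → ℝ} (hψ : IsPhys ψ) :
    l2 (fun U : GaugeConfig 3 L G => (Fintype.card (Site 3 L) : ℝ)⁻¹ * ∑ v : Site 3 L, ψ (thin L' (torusConfigShift v U)))
       (fun U : GaugeConfig 3 L G => (Fintype.card (Site 3 L) : ℝ)⁻¹ * ∑ v : Site 3 L, ψ (thin L' (torusConfigShift v U)))
      ≤ l2 ψ ψ := by
  set N : ℝ := (Fintype.card (Site 3 L) : ℝ) with hN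
  have hNpos : 0 < N := by rw [hN]; exact_mod_cast Fintype.card_pos
  have hN0 : N ≠ 0 := hNpos.ne'
  have havg := isPhys_avg_thin_shift hLL h2 hψ
  have hsq : ∀ v : Site 3 L, IsPhys fun U : GaugeConfig 3 L G => ψ (thin L' (torusConfigShift v U)) ^ 2 := by
    intro v
    have h := isPhys_thin_shift hLL h2 hψ v
    obtain ⟨C, hC⟩ := h.bounded
    refine ⟨h.measurable.pow_const 2, ⟨C ^ 2, fun U => ?_⟩, fun g U => ?_, fun k z hz U => ?_⟩
    · rw [abs_pow]; exact pow_le_pow_left₀ (abs_nonneg _) (hC U) 2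
    · show ψ (thin L' (torusConfigShift v (gaugeTransform g U))) ^ 2 = ψ (thin L' (torusConfigShift v U)) ^ 2
      rw [h.gaugeInv g U]
    · show ψ (thin L' (torusConfigShift v (twist k z U))) ^ 2 = ψ (thin L' (torusConfigShift v U)) ^ 2
      rw [h.zeroFlux k z hz U]
  -- pointwise Jensen: `(N⁻¹ Σ a_v)² ≤ N⁻¹ Σ a_v²`
  have hpt : ∀ U : GaugeConfig 3 L G,
      (N⁻¹ * ∑ v : Site 3 L, ψ (thin L' (torusConfigShift v U))) * (N⁻¹ * ∑ v : Site 3 L, ψ (thin L' (torusConfigShift v U))) ≤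
        N⁻¹ * ∑ v : Site 3 L, ψ (thin L' (torusConfigShift v U)) ^ 2 := by
    intro U
    have hJ := sq_sum_le_card_mul_sum_sq (s := (Finset.univ : Finset (Site 3 L)))
      (f := fun v => ψ (thin L' (torusConfigShift v U)))
    rw [Finset.card_univ, ← hN] at hJ
    have : (N⁻¹ * ∑ v : Site 3 L, ψ (thin L' (torusConfigShift v U))) * (N⁻¹ * ∑ v : Site 3 L, ψ (thin L' (torusConfigShift v U))) =
        N⁻¹ * (N⁻¹ * (∑ v : Site 3 L, ψ (thin L' (torusConfigShift v U))) ^ 2) := by ring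
    rw [this]
    refine mul_le_mul_of_nonneg_left ?_ (inv_nonneg.mpr hNpos.le)
    rw [inv_mul_le_iff₀ hNpos]
    exact hJ
  -- integrate
  have hI1 : Integrable (fun U : GaugeConfig 3 L G =>
      (N⁻¹ * ∑ v : Site 3 L, ψ (thin L' (torusConfigShift v U))) * (N⁻¹ * ∑ v : Site 3 L, ψ (thin L' (torusConfigShift v U))))
      (configMeasure G L) := by
    have := havg.integrable_sq
    simpa only [sq, hN] using this
  have hI2 : Integrable (fun U : GaugeConfig 3 L G => N⁻¹ * ∑ v : Site 3 L, ψ (thin L' (torusConfigShift v U)) ^ 2) (configMeasure G L) :=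
    (integrable_finsetSum _ fun v _ => (hsq v).integrable).const_mul _
  have hterm : ∀ v : Site 3 L, ∫ U, ψ (thin L' (torusConfigShift v U)) ^ 2 ∂configMeasure G L = l2 ψ ψ := by
    intro v
    rw [integral_comp_torusConfigShift v (fun U => ψ (thin L' U) ^ 2), integral_comp_thin hLL (hψ.measurable.pow_const 2)]
    unfold l2
    simp only [sq]
  unfold l2
  calc ∫ U, (N⁻¹ * ∑ v : Site 3 L, ψ (thin L' (torusConfigShift v U))) * (N⁻¹ * ∑ v : Site 3 L, ψ (thin L' (torusConfigShift v U)))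
        ∂configMeasure G L
      ≤ ∫ U, N⁻¹ * ∑ v : Site 3 L, ψ (thin L' (torusConfigShift v U)) ^ 2 ∂configMeasure G L := integral_mono hI1 hI2 hpt
    _ = N⁻¹ * ∑ v : Site 3 L, ∫ U, ψ (thin L' (torusConfigShift v U)) ^ 2 ∂configMeasure G L := by
        rw [integral_const_mul, integral_finsetSum _ fun v _ => (hsq v).integrable]
    _ = ∫ V, ψ V * ψ V ∂configMeasure G L' := by
        simp only [hterm, Finset.sum_const, Finset.card_univ, nsmul_eq_mul]
        rw [← hN, inv_mul_cancel_left₀ hN0]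
        rfl

end Averaged

end Summit.QuantumFields.YangMills.Theorems.FemtoCutoffLadder.Thinning

end
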